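import Literature.Probability.LatticeModels.PointwiseScalingLimitEtaExists
import HarnessLib

/-!
# The dilation covariance rate gives a power rate for the octave ratio of block variances
(routes CoerciveSharpness / ClusterRigidity / HelsonAxis, crux `DimensionPinned`,
item stmt-CriticalPhenomena-4662, line `Sketch` (idea `octave-telescoping-block-dock`),
registered stub `stub_lambdaRate`)

Write `G := criticalTwoPoint 3` (the plus-state two-point function of the nearest-neighbour Ising
model on `ℤ³` at `β_c`), `Q_L := [0, L)³ ∩ ℤ³` (`Fintype.piFinset fun _ => Finset.Ico 0 L`),
`Q_L(u) := L • u + Q_L` (`Fintype.piFinset fun i => Finset.Ico (L * u i) (L * u i + L)`), the block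
covariance `C_L(u) := Σ_{x ∈ Q_L} Σ_{y ∈ Q_L(u)} G (y - x)`, the block variance
`V_L := C_L(0) = Σ_{x, y ∈ Q_L} G (y - x)` and `R_L(u) := C_L(u) / V_L`.

`stub_lambdaRate`: if `|R_{2L}(u) - R_L(u)| ≤ C L^{-θ}` for `L ≥ 1` and the 27 displacements
`u ∈ {-1, 0, 1}³` (the hypothesis DCR₂₇ of the line), then for `L ≥ 1`
`8 ≤ V_{2L} / V_L` and `|V_{4L} / V_{2L} - V_{2L} / V_L| ≤ 64 C L^{-θ}`.

Proof.  The exact sub-block recursion `V_{2M} = Σ_{i, j ∈ {0,1}³} C_M(j - i)`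
(`lambdaRate_variance_two_mul`): split `Q_{2M} = ⊔_{i ∈ {0,1}³} (M • i + Q_M)` in both variables
(`lambdaRate_sum_cube_two_mul`, a fiberwise sum over the block index
`k ↦ if x_k < M then 0 else 1`) and translate both variables by `-M • i`
(`lambdaRate_sum_pair_translate`), which leaves `y - x` unchanged.  Applied at `M = L` and
`M = 2L` and divided by `V_L`, resp. `V_{2L}`, it gives
`V_{2L} / V_L = Σ_{i,j} R_L(j - i)` and `V_{4L} / V_{2L} = Σ_{i,j} R_{2L}(j - i)`, so the
difference is at most `64 · C L^{-θ}` (`|j_k - i_k| ≤ 1`), while `8 ≤ V_{2L} / V_L` comes from the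
`8` diagonal terms `i = j` (`C_L(0) = V_L`) and `G ≥ 0` (Griffiths) on the other `56`; `V_L > 0`
because the term `x = y = 0` equals `G 0 = 1` (`lambdaRate_octave_abstract`, `lambdaRate_var_pos`).

References: elementary (finite sums); the only model inputs are `G ≥ 0` and `G 0 = 1`
(`criticalTwoPoint_nonneg'`, `criticalTwoPoint_zero'`).  No definitions are introduced.
-/

noncomputable section

namespace Summit.CriticalPhenomena.Ising3DConformalLimit.Theorems.CoerciveSharpnessDimensionPinned

open scoped BigOperators
open Finset Literature.Probability.LatticeModels

/-- Membership in the block-index set `{0, 1}`. [folklore] -/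
private theorem lambdaRate_mem_zero_one {a : ℤ} : a ∈ ({0, 1} : Finset ℤ) ↔ a = 0 ∨ a = 1 := by
  simp

/-- **Splitting a cube of side `2M` into `8` cubes of side `M`**:
`Σ_{x ∈ Q_{2M}} g x = Σ_{i ∈ {0,1}³} Σ_{x ∈ M • i + Q_M} g x` (`0 < M`). [folklore] -/
private theorem lambdaRate_sum_cube_two_mul {M : ℤ} (hM : 0 < M) (g : (Fin 3 → ℤ) → ℝ) :
    ∑ x ∈ Fintype.piFinset (fun _ : Fin 3 => Finset.Ico (0:ℤ) (2 * M)), g x =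
      ∑ i ∈ Fintype.piFinset (fun _ : Fin 3 => ({0, 1} : Finset ℤ)),
        ∑ x ∈ Fintype.piFinset (fun k : Fin 3 => Finset.Ico (M * i k) (M * i k + M)), g x := by
  have hmaps : ∀ x ∈ Fintype.piFinset (fun _ : Fin 3 => Finset.Ico (0:ℤ) (2 * M)),
      (fun k => if x k < M then (0:ℤ) else 1) ∈
        Fintype.piFinset (fun _ : Fin 3 => ({0, 1} : Finset ℤ)) := by
    intro x _
    rw [Fintype.mem_piFinset]
    intro k
    split_ifs <;> simp
  rw [← Finset.sum_fiberwise_of_maps_to hmaps g]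
  refine Finset.sum_congr rfl fun i hi => Finset.sum_congr ?_ fun _ _ => rfl
  rw [Fintype.mem_piFinset] at hi
  ext x
  simp only [Finset.mem_filter, Fintype.mem_piFinset, funext_iff, Finset.mem_Ico]
  constructor
  · rintro ⟨hx, hb⟩ k
    have h1 := hx k
    have h2 := hb k
    split_ifs at h2 with h
    · rw [← h2]
      omega
    · rw [← h2]
      omega
  · intro hx
    constructor
    · intro k
      have h1 := hx k
      rcases lambdaRate_mem_zero_one.1 (hi k) with h3 | h3 <;> rw [h3] at h1 <;> omega
    · intro k
      have h1 := hx k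
      rcases lambdaRate_mem_zero_one.1 (hi k) with h3 | h3 <;> rw [h3] at h1 ⊢ <;>
        split_ifs with h <;> omega

/-- **Translating a pair of sub-cubes**: for block indices `i, j`,
`Σ_{x ∈ M•i + Q_M} Σ_{y ∈ M•j + Q_M} φ (y - x) = Σ_{x ∈ Q_M} Σ_{y ∈ M•(j-i) + Q_M} φ (y - x)`
(shift both variables by `-M • i`). [folklore] -/
private theorem lambdaRate_sum_pair_translate (M : ℤ) (i j : Fin 3 → ℤ) (φ : (Fin 3 → ℤ) → ℝ) :
    ∑ x ∈ Fintype.piFinset (fun k : Fin 3 => Finset.Ico (M * i k) (M * i k + M)),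
        ∑ y ∈ Fintype.piFinset (fun k : Fin 3 => Finset.Ico (M * j k) (M * j k + M)), φ (y - x) =
      ∑ x ∈ Fintype.piFinset (fun _ : Fin 3 => Finset.Ico (0:ℤ) M),
        ∑ y ∈ Fintype.piFinset (fun k : Fin 3 => Finset.Ico (M * (j - i) k) (M * (j - i) k + M)),
          φ (y - x) := by
  refine Finset.sum_nbij' (fun x => x - fun k => M * i k) (fun x => x + fun k => M * i k)
    ?_ ?_ ?_ ?_ ?_
  · intro x hx
    rw [Fintype.mem_piFinset] at hx ⊢
    intro k
    have h := hx k
    simp only [Finset.mem_Ico, Pi.sub_apply] at h ⊢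
    omega
  · intro x hx
    rw [Fintype.mem_piFinset] at hx ⊢
    intro k
    have h := hx k
    simp only [Finset.mem_Ico, Pi.add_apply] at h ⊢
    omega
  · intro x _
    exact sub_add_cancel x _
  · intro x _
    exact add_sub_cancel_right x _
  · intro x _
    refine Finset.sum_nbij' (fun y => y - fun k => M * i k) (fun y => y + fun k => M * i k)
      ?_ ?_ ?_ ?_ ?_
    · intro y hy
      rw [Fintype.mem_piFinset] at hy ⊢
      intro k
      have h := hy k
      simp only [Finset.mem_Ico, Pi.sub_apply, mul_sub] at h ⊢
      omega
    · intro y hy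
      rw [Fintype.mem_piFinset] at hy ⊢
      intro k
      have h := hy k
      simp only [Finset.mem_Ico, Pi.sub_apply, Pi.add_apply, mul_sub] at h ⊢
      omega
    · intro y _
      exact sub_add_cancel y _
    · intro y _
      exact add_sub_cancel_right y _
    · intro y _
      rw [sub_sub_sub_cancel_right]

/-- **The exact sub-block recursion for block variances**:
`V_{2M} = Σ_{i, j ∈ {0,1}³} C_M(j - i)`, i.e.
`Σ_{x, y ∈ Q_{2M}} φ (y - x) = Σ_{i,j ∈ {0,1}³} Σ_{x ∈ Q_M} Σ_{y ∈ M•(j-i) + Q_M} φ (y - x)`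
(`0 < M`). [folklore] -/
private theorem lambdaRate_variance_two_mul {M : ℤ} (hM : 0 < M) (φ : (Fin 3 → ℤ) → ℝ) :
    ∑ x ∈ Fintype.piFinset (fun _ : Fin 3 => Finset.Ico (0:ℤ) (2 * M)),
        ∑ y ∈ Fintype.piFinset (fun _ : Fin 3 => Finset.Ico (0:ℤ) (2 * M)), φ (y - x) =
      ∑ i ∈ Fintype.piFinset (fun _ : Fin 3 => ({0, 1} : Finset ℤ)),
        ∑ j ∈ Fintype.piFinset (fun _ : Fin 3 => ({0, 1} : Finset ℤ)),
          ∑ x ∈ Fintype.piFinset (fun _ : Fin 3 => Finset.Ico (0:ℤ) M),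
            ∑ y ∈ Fintype.piFinset (fun k : Fin 3 =>
              Finset.Ico (M * (j - i) k) (M * (j - i) k + M)), φ (y - x) := by
  rw [lambdaRate_sum_cube_two_mul hM]
  refine Finset.sum_congr rfl fun i _ => ?_
  calc ∑ x ∈ Fintype.piFinset (fun k : Fin 3 => Finset.Ico (M * i k) (M * i k + M)),
          ∑ y ∈ Fintype.piFinset (fun _ : Fin 3 => Finset.Ico (0:ℤ) (2 * M)), φ (y - x)
        = ∑ x ∈ Fintype.piFinset (fun k : Fin 3 => Finset.Ico (M * i k) (M * i k + M)),
            ∑ j ∈ Fintype.piFinset (fun _ : Fin 3 => ({0, 1} : Finset ℤ)),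
              ∑ y ∈ Fintype.piFinset (fun k : Fin 3 => Finset.Ico (M * j k) (M * j k + M)),
                φ (y - x) :=
          Finset.sum_congr rfl fun x _ => lambdaRate_sum_cube_two_mul hM _
    _ = ∑ j ∈ Fintype.piFinset (fun _ : Fin 3 => ({0, 1} : Finset ℤ)),
          ∑ x ∈ Fintype.piFinset (fun k : Fin 3 => Finset.Ico (M * i k) (M * i k + M)),
            ∑ y ∈ Fintype.piFinset (fun k : Fin 3 => Finset.Ico (M * j k) (M * j k + M)),
              φ (y - x) :=
          Finset.sum_comm
    _ = _ := Finset.sum_congr rfl fun j _ => lambdaRate_sum_pair_translate M i j φ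

/-- **Positivity of the block variance**: `0 < V_M` for `0 < M`, since every term is `≥ 0`
(Griffiths) and the term `x = y = 0` equals `G 0 = 1`. [folklore] -/
private theorem lambdaRate_var_pos {M : ℤ} (hM : 0 < M) :
    0 < ∑ x ∈ Fintype.piFinset (fun _ : Fin 3 => Finset.Ico (0:ℤ) M),
      ∑ y ∈ Fintype.piFinset (fun _ : Fin 3 => Finset.Ico (0:ℤ) M), criticalTwoPoint 3 (y - x) := by
  have h0 : (0 : Fin 3 → ℤ) ∈ Fintype.piFinset (fun _ : Fin 3 => Finset.Ico (0:ℤ) M) :=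
    Fintype.mem_piFinset.2 fun _ => Finset.mem_Ico.2 ⟨le_rfl, hM⟩
  calc (0:ℝ) < 1 := one_pos
    _ = criticalTwoPoint 3 ((0 : Fin 3 → ℤ) - 0) := by
        rw [sub_zero]
        exact criticalTwoPoint_zero'.symm
    _ ≤ ∑ y ∈ Fintype.piFinset (fun _ : Fin 3 => Finset.Ico (0:ℤ) M),
          criticalTwoPoint 3 (y - (0 : Fin 3 → ℤ)) :=
        Finset.single_le_sum (f := fun y : Fin 3 → ℤ => criticalTwoPoint 3 (y - 0))
          (fun y _ => criticalTwoPoint_nonneg' _) h0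
    _ ≤ ∑ x ∈ Fintype.piFinset (fun _ : Fin 3 => Finset.Ico (0:ℤ) M),
          ∑ y ∈ Fintype.piFinset (fun _ : Fin 3 => Finset.Ico (0:ℤ) M),
            criticalTwoPoint 3 (y - x) :=
        Finset.single_le_sum (f := fun x : Fin 3 → ℤ =>
            ∑ y ∈ Fintype.piFinset (fun _ : Fin 3 => Finset.Ico (0:ℤ) M),
              criticalTwoPoint 3 (y - x))
          (fun x _ => Finset.sum_nonneg fun y _ => criticalTwoPoint_nonneg' _) h0

/-- Block indices `i, j ∈ {0,1}³` differ coordinatewise by at most `1`. [folklore] -/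
private theorem lambdaRate_abs_sub_apply_le_one {i j : Fin 3 → ℤ}
    (hi : i ∈ Fintype.piFinset (fun _ : Fin 3 => ({0, 1} : Finset ℤ)))
    (hj : j ∈ Fintype.piFinset (fun _ : Fin 3 => ({0, 1} : Finset ℤ))) (k : Fin 3) :
    |(j - i) k| ≤ 1 := by
  rw [Fintype.mem_piFinset] at hi hj
  have h1 := lambdaRate_mem_zero_one.1 (hi k)
  have h2 := lambdaRate_mem_zero_one.1 (hj k)
  rw [Pi.sub_apply, abs_le]
  omega

/-- **The abstract octave step** (pure real algebra on finite sums): if `V₂ = Σ_{i,j ∈ T} A i j`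
with `A ≥ 0` and diagonal `A i i = V₁ > 0`, `V₄ = Σ_{i,j ∈ T} B i j`, and
`|B i j / V₂ - A i j / V₁| ≤ K` on `T × T`, then `#T ≤ V₂ / V₁` and
`|V₄ / V₂ - V₂ / V₁| ≤ (#T)² K`. [folklore] -/
private theorem lambdaRate_octave_abstract {ι : Type*} (T : Finset ι) (A B : ι → ι → ℝ)
    (V1 V2 V4 K n : ℝ) (hn : (T.card : ℝ) = n) (hV1 : 0 < V1)
    (hV2 : ∑ i ∈ T, ∑ j ∈ T, A i j = V2) (hV4 : ∑ i ∈ T, ∑ j ∈ T, B i j = V4)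
    (hA : ∀ i ∈ T, ∀ j ∈ T, 0 ≤ A i j) (hdiag : ∀ i ∈ T, A i i = V1)
    (hK : ∀ i ∈ T, ∀ j ∈ T, |B i j / V2 - A i j / V1| ≤ K) :
    n ≤ V2 / V1 ∧ |V4 / V2 - V2 / V1| ≤ n ^ 2 * K := by
  subst hn
  constructor
  · rw [le_div_iff₀ hV1, ← hV2]
    calc (T.card : ℝ) * V1 = ∑ i ∈ T, A i i := by
          rw [Finset.sum_congr rfl hdiag, Finset.sum_const, nsmul_eq_mul]
      _ ≤ ∑ i ∈ T, ∑ j ∈ T, A i j :=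
          Finset.sum_le_sum fun i hi => Finset.single_le_sum (fun j hj => hA i hi j hj) hi
  · have h1 : V4 / V2 = ∑ i ∈ T, ∑ j ∈ T, B i j / V2 := by
      rw [← hV4]
      simp only [Finset.sum_div]
    have h2 : V2 / V1 = ∑ i ∈ T, ∑ j ∈ T, A i j / V1 := by
      rw [← hV2]
      simp only [Finset.sum_div]
    have e : V4 / V2 - V2 / V1 = ∑ i ∈ T, ∑ j ∈ T, (B i j / V2 - A i j / V1) := by
      rw [h1, h2]
      simp only [Finset.sum_sub_distrib]
    rw [e]
    calc |∑ i ∈ T, ∑ j ∈ T, (B i j / V2 - A i j / V1)|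
          ≤ ∑ i ∈ T, |∑ j ∈ T, (B i j / V2 - A i j / V1)| := Finset.abs_sum_le_sum_abs _ _
      _ ≤ ∑ i ∈ T, ∑ j ∈ T, |B i j / V2 - A i j / V1| :=
          Finset.sum_le_sum fun i _ => Finset.abs_sum_le_sum_abs _ _
      _ ≤ ∑ i ∈ T, ∑ j ∈ T, K :=
          Finset.sum_le_sum fun i hi => Finset.sum_le_sum fun j hj => hK i hi j hj
      _ = (T.card : ℝ) ^ 2 * K := by
          rw [Finset.sum_const, Finset.sum_const, smul_smul, nsmul_eq_mul]
          push_cast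
          ring

/-- **stub `stub_lambdaRate` — DCR₂₇ gives a power rate for the octave ratio of block
variances.**  If `|R_{2L}(u) - R_L(u)| ≤ C L^{-θ}` for `L ≥ 1` and `u ∈ {-1,0,1}³`, then
`8 ≤ V_{2L} / V_L` and `|V_{4L} / V_{2L} - V_{2L} / V_L| ≤ 64 C L^{-θ}` for `L ≥ 1`, by the exact
sub-block recursion `V_{2M} = Σ_{i,j ∈ {0,1}³} C_M(j - i)` at `M = L, 2L` and `G ≥ 0`, `G 0 = 1`.
[folklore] -/
theorem stub_lambdaRate :
    (∃ θ C : ℝ, 0 < θ ∧ ∀ L : ℕ, 1 ≤ L → ∀ u : Fin 3 → ℤ, (∀ i, |u i| ≤ 1) →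
      |(∑ x ∈ Fintype.piFinset (fun _ : Fin 3 => Finset.Ico (0:ℤ) (2 * (L:ℤ))),
          ∑ y ∈ Fintype.piFinset (fun i : Fin 3 => Finset.Ico (2 * (L:ℤ) * u i) (2 * (L:ℤ) * u i + 2 * (L:ℤ))),
            criticalTwoPoint 3 (y - x)) /
        (∑ x ∈ Fintype.piFinset (fun _ : Fin 3 => Finset.Ico (0:ℤ) (2 * (L:ℤ))),
          ∑ y ∈ Fintype.piFinset (fun _ : Fin 3 => Finset.Ico (0:ℤ) (2 * (L:ℤ))), criticalTwoPoint 3 (y - x)) -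
       (∑ x ∈ Fintype.piFinset (fun _ : Fin 3 => Finset.Ico (0:ℤ) (L:ℤ)),
          ∑ y ∈ Fintype.piFinset (fun i : Fin 3 => Finset.Ico ((L:ℤ) * u i) ((L:ℤ) * u i + (L:ℤ))),
            criticalTwoPoint 3 (y - x)) /
        (∑ x ∈ Fintype.piFinset (fun _ : Fin 3 => Finset.Ico (0:ℤ) (L:ℤ)),
          ∑ y ∈ Fintype.piFinset (fun _ : Fin 3 => Finset.Ico (0:ℤ) (L:ℤ)), criticalTwoPoint 3 (y - x))|
      ≤ C * (L : ℝ) ^ (-θ)) →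
    ∃ θ C : ℝ, 0 < θ ∧ ∀ L : ℕ, 1 ≤ L →
      8 ≤ (∑ x ∈ Fintype.piFinset (fun _ : Fin 3 => Finset.Ico (0:ℤ) (2 * (L:ℤ))),
              ∑ y ∈ Fintype.piFinset (fun _ : Fin 3 => Finset.Ico (0:ℤ) (2 * (L:ℤ))), criticalTwoPoint 3 (y - x)) /
            (∑ x ∈ Fintype.piFinset (fun _ : Fin 3 => Finset.Ico (0:ℤ) (L:ℤ)),
              ∑ y ∈ Fintype.piFinset (fun _ : Fin 3 => Finset.Ico (0:ℤ) (L:ℤ)), criticalTwoPoint 3 (y - x)) ∧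
      |(∑ x ∈ Fintype.piFinset (fun _ : Fin 3 => Finset.Ico (0:ℤ) (4 * (L:ℤ))),
          ∑ y ∈ Fintype.piFinset (fun _ : Fin 3 => Finset.Ico (0:ℤ) (4 * (L:ℤ))), criticalTwoPoint 3 (y - x)) /
        (∑ x ∈ Fintype.piFinset (fun _ : Fin 3 => Finset.Ico (0:ℤ) (2 * (L:ℤ))),
          ∑ y ∈ Fintype.piFinset (fun _ : Fin 3 => Finset.Ico (0:ℤ) (2 * (L:ℤ))), criticalTwoPoint 3 (y - x)) -
       (∑ x ∈ Fintype.piFinset (fun _ : Fin 3 => Finset.Ico (0:ℤ) (2 * (L:ℤ))),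
          ∑ y ∈ Fintype.piFinset (fun _ : Fin 3 => Finset.Ico (0:ℤ) (2 * (L:ℤ))), criticalTwoPoint 3 (y - x)) /
        (∑ x ∈ Fintype.piFinset (fun _ : Fin 3 => Finset.Ico (0:ℤ) (L:ℤ)),
          ∑ y ∈ Fintype.piFinset (fun _ : Fin 3 => Finset.Ico (0:ℤ) (L:ℤ)), criticalTwoPoint 3 (y - x))|
      ≤ C * (L : ℝ) ^ (-θ) := by
  rintro ⟨θ, C, hθ, hC⟩
  refine ⟨θ, 64 * C, hθ, fun L hL => ?_⟩
  have hL0 : (0:ℤ) < (L:ℤ) := by omega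
  have h2L0 : (0:ℤ) < 2 * (L:ℤ) := by omega
  have hcard : ((Fintype.piFinset fun _ : Fin 3 => ({0, 1} : Finset ℤ)).card : ℝ) = 8 := by
    rw [Fintype.card_piFinset]
    norm_num
  rw [show (64:ℝ) * C * (L:ℝ) ^ (-θ) = 8 ^ 2 * (C * (L:ℝ) ^ (-θ)) by ring,
    show (4:ℤ) * (L:ℤ) = 2 * (2 * (L:ℤ)) by ring]
  refine lambdaRate_octave_abstract _ _ _ _ _ _ _ 8 hcard (lambdaRate_var_pos hL0)
    (lambdaRate_variance_two_mul hL0 (criticalTwoPoint 3)).symm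
    (lambdaRate_variance_two_mul h2L0 (criticalTwoPoint 3)).symm ?_ ?_ ?_
  · intro i _ j _
    exact Finset.sum_nonneg fun x _ => Finset.sum_nonneg fun y _ => criticalTwoPoint_nonneg' _
  · intro i _
    simp only [sub_self, Pi.zero_apply, mul_zero, zero_add]
  · intro i hi j hj
    exact hC L hL (j - i) fun k => lambdaRate_abs_sub_apply_le_one hi hj k

end Summit.CriticalPhenomena.Ising3DConformalLimit.Theorems.CoerciveSharpnessDimensionPinned

end
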